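import Summits.QuantumFields.YangMills.Theorems.BalabanUVNodesN22WindowSoftTwoPointTorus
import Literature.MathematicalPhysics.QuantumFieldTheory.Balaban1983to89.Node00.U3KernelLetters

/-!
# NODE N22 (NE9) — THE SOFT-LOCALIZED ROAD AT def-T's CATALOGUE OF RECORD `Sect2.domSys (F.P K) M j`: the «compatible partitions» arithmetic
# `domCount·M = 2L^{m+K−j}` for `M = L^{m′}` and all large `K`, and the windowed `hK` ∕ windowed decay with the terms indexed EXACTLY as W1-20's localized sum

Cell `pub-ymgap`, Track A (HUMAN RULING D-0062), WIDTH SEAT `dag-n22-w2` (g2) on node n22 = NE9; `--kind proof --supports stmt-QuantumFields-20544 --as helper`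
(K3⁷ `SpineGivenEndpointR13SepCoPH`), COUNT-NEUTRAL; THEOREMS ONLY (0 `def`, 0 `sorry`, standard axioms).  Third storey of this seat's soft road
(`…N22WindowSoftTwoPoint` → `…Torus` → this).  The previous storey's `…_torusCast` theorems take cube counts `N K`, a cube side `M`, the EVENTUAL divisibility
`N K * M ∣ (F.P K).sitesPerDir j` and `N K * M → ∞`.  OF RECORD the (1.7) terms are indexed by def-T's catalogue `Node00.Sect2.domSys (F.P K) M j = tsys 4 (domCount (F.P K) M j)`
(`Node00/Sect2FrameOfRecord`, located reading (ℓ1): «its wrap-around adjacency is the geometric one iff L^j M · domCount = 2L^{m+K} (exact tiling) — a numeric side condition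
… of the “compatible partitions” kind, not displayed»), and W1-20's `localizedSum F S emb k hist K W = Σ_{X : (domSys (F.P K) M (k+1)).Dom} …`.  THIS FILE proves that side
condition for print's cube sides `M = L^{m′}` ([I] p. 257 «cubes of a size M, where M = L^m») at every `K ≥ j + m′ − m` (`domCount_mul_eq_sitesPerDir_of_pow`: `(2L^{m+K} − 1) ∕ (L^jM) + 1 =
2L^{m+K−j−m′}`, times `M` = `2L^{m+K−j} = sitesPerDir j`), hence eventually in `K`, and restates the two `…_torusCast` outputs with `N K := domCount (F.P K) M j` — the terms
`ℰ K : (Sect2.domSys (F.P K) M j).Dom → …` now have W1-20's index type on the nose.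

WHAT.  §1 `div_add_one_of_mul` (`(a·s − 1)∕s + 1 = a` in `ℕ`), ★ `domCount_mul_eq_sitesPerDir_of_pow` (`K ≥ j + m′ − m` ⇒ `domCount (F.P K) (L^{m′}) j · L^{m′} = (F.P K).sitesPerDir j`),
`eventually_sitesPerDir_eq_domCount_mul`, `eventually_domCount_mul_dvd`, `tendsto_domCount_mul`.  §2 ★★ `eventually_abs_polWindow_sum_sub_le_domSys` (w3's windowed input from
K-uniform per-term soft bounds over the catalogue of record, sites cast by `ZMod.cast` onto `(ℤ∕domCount·M)⁴`; constants `C_E e^{12Mδ₁}K₀(64,8)K₁(4,δ₀∕2)`, `δ₁ = ½min{δ₀, κ(4M)⁻¹}`),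
`eventually_abs_polWindow_sum_sub_le_domSys_hK` (w3's shape, moduli `C·Λ`), ★★ `eventually_abs_polWindow_sum_le_domSys` (value twin: the windowed (5.10)-decay input of (D4)).
§3 `softBound_of_weighted` — the arithmetic junction from module J28's SOFT per-term output shape `≤ 16·M∕r²·(w_x·w_y)` (`hterm_of_holomorphic_weighted`, dag-n22-c p596444) with
`M ≤ M₀·w_h·e^{−κd_j}` and weights `w ≤ B₃·e^{−δ₀dist}` to this road's `hterm` shape, `C_E := 16 M₀ B₃²∕r²`.  §4 `softBound_of_repr435` — the same junction from the
PRINTED route's (4.35)-shaped leaves (a form on the minimizer responses, `B12Decay510.kernelBound_of_repr435`'s shape) at one pair of sites, `C_E := A B₃²`.  §5 ★★ `eventually_le_of_softSum_domSys`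
— the Σ-junction AT THE CATALOGUE OF RECORD with the cast geometry assembled inside the proof: per-`K` bounds `Δ K ≤ Σ_X a K X` (module J29's soft edition
`abs_polWindow_localizedSum_sub_le_soft`, p597338, at `localizedSum`) + K-uniform soft majorants ⇒ `∀ᶠ K, Δ K ≤ C_E e^{12Mδ₁}K₀(64,8)K₁(4,δ₀∕2)·w·e^{−δ₁|z|₁}` = dag-n22-w3's `hK`.
§6 ★★★ `windowedNE9_localizedSum_of_softSum` — CAPSTONE: W1-19b's binder `WindowedNE9 F (localizedSum F S emb) ρ bV W δ₁ (C·Λ)` from J29-soft's Σ-bounds at every `(g, g′, k, μ, ν, z, K)`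
and soft majorants with constants uniform in all of them (the `hK` of dag-n22-w3's (1.21) passage in LETTER currency; imports W1-19b `Node00/U3KernelLetters`);
★★★ `windowedDecay_localizedSum_of_softSum` — the VALUE letter `WindowedDecay F (localizedSum F S emb) ρ bV W μ ν δ₁` likewise (the (D4) road's windowed input).

HONEST FRAMING (binding).  Count-neutral bookkeeping (`ℕ` arithmetic + instantiation); the per-term soft bounds stay DISPLAYED (NODE A ∕ NODE O ∕ J-road); nothing of
Bałaban's asserted; N22 NOT discharged (typed 28∕28 · discharged 5∕27 UNCHANGED); K3⁷ OPEN, not claimed; no count claim (the chair's single count line is the only count); one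
finite 𝕋⁴ programme at fixed ε — R4 closes the CONDITIONAL rung `BalabanLadder.UV` only; NOTHING about the continuum limit, ℝ⁴, OS axioms, a mass gap or the Clay problem is
proved or claimed.  References (TYPES only): [I] = Bałaban, CMP 109 (1987) p. 257, (1.21) p. 264, p. 282, (5.10) p. 293.
-/

noncomputable section

open Filter Topology
open scoped BigOperators

namespace YMDAG.N22.WindowSoftTwoPoint

open Literature.MathematicalPhysics.QuantumFieldTheory.Balaban1983to89
open Literature.MathematicalPhysics.QuantumFieldTheory.Balaban1983to89.T4Continuum (T4Family)
open Literature.MathematicalPhysics.QuantumFieldTheory.Balaban1983to89.B12PolarizationTensor120 (polComp expChart)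
open Literature.MathematicalPhysics.QuantumFieldTheory.Balaban1983to89.Node00 (polScalar polWindow siteOfInt)
open Literature.MathematicalPhysics.QuantumFieldTheory.Balaban1983to89.Node00.Sect2 (domCount domSys)
open Literature.MathematicalPhysics.QuantumFieldTheory.Balaban1983to89.Node00.LocalizedSum17 (localizedSum ReadingMaps)
open Literature.MathematicalPhysics.QuantumFieldTheory.Balaban1983to89.Node00.W1 (ClusterTower)
open Literature.MathematicalPhysics.QuantumFieldTheory.Balaban1983to89.Node00.U3OfKernels (histPrefix)
open Literature.MathematicalPhysics.QuantumFieldTheory.Balaban1983to89.Node00.U3KernelLetters (WindowedNE9 windowedNE9_iff WindowedDecay windowedDecay_iff)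
open Literature.MathematicalPhysics.QuantumFieldTheory.Balaban1983to89.B12Decay510
  (SiteGeometry GeomLeaf CubeSumLeaf TreeLeaf delta1 delta1_nonneg delta1_le_half delta1_mul_le)
open Literature.MathematicalPhysics.QuantumFieldTheory.Balaban1983to89.B12Decay510Window (K₁ K₁_nonneg)
open Literature.MathematicalPhysics.QuantumFieldTheory.Balaban1983to89.B12Decay510Torus (pl1 geomT geomLeafT cubeSumLeafT treeLeafT distCT nearT)
open Literature.MathematicalPhysics.QuantumFieldTheory.Balaban1983to89.B12TreeDecay (K₀ kappa₀ K₀_pos kappa₀_nonneg)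
open Literature.MathematicalPhysics.QuantumFieldTheory.Balaban1983to89.TreeLengthTorus (TPt TDom tsys tcubeSys torusTreeLen)
open Literature.MathematicalPhysics.QuantumFieldTheory.Balaban1983to89.B12Sec2to5 (l1)

/-! ## §1 The «compatible partitions» arithmetic: `domCount · M = sitesPerDir j` for `M = L^{m′}`, `K ≥ j + m′ − m` -/

/-- `ℕ` bookkeeping behind def-T's ceiling convention: `(a·s − 1)∕s + 1 = a` for `a, s ≥ 1`. -/
theorem div_add_one_of_mul {a s : ℕ} (ha : 1 ≤ a) (hs : 1 ≤ s) : (a * s - 1) / s + 1 = a := by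
  have hprod : 1 ≤ a * s := Nat.mul_le_mul ha hs
  have e0 : a - 1 + 1 = a := by omega
  have e1 : (a - 1) * s + s = a * s := by
    conv_rhs => rw [← e0]
    ring
  have h1 : (a * s - 1) / s = a - 1 := by
    apply Nat.div_eq_of_lt_le
    · omega
    · rw [e0]; omega
  omega

variable (F : T4Family)

/-- ★ **EXACT TILING OF `T^{(j)}` BY `L^{m′}`-CUBES** ([I] p. 257 «cubes of a size M, where M = L^m»): for `K ≥ j + m′ − m` the cube count per direction of def-T's catalogue
`Sect2.domCount (F.P K) (L^{m′}) j = ⌈2L^{m+K}∕(L^j·L^{m′})⌉` times the cube side `L^{m′}` IS the site count `(F.P K).sitesPerDir j = 2L^{m+K−j}` of the level-`j` torus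
(def-T's located reading (ℓ1) «exact tiling», discharged for print's `M`). -/
theorem domCount_mul_eq_sitesPerDir_of_pow (j m' K : ℕ) (hK : j + m' ≤ F.m + K) :
    domCount (F.P K) (F.L ^ m') j * F.L ^ m' = (F.P K).sitesPerDir j := by
  have hL : 1 ≤ F.L := by have := F.hL.2; omega
  have hpow : ∀ n : ℕ, 1 ≤ F.L ^ n := fun n => Nat.one_le_pow _ _ hL
  simp only [Node00.Sect2.domCount, B14.Eq213MaximalDomains.side, Params.sitesPerDir, T4Family.P_L, T4Family.P_m, T4Family.P_K, Nat.sub_zero]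
  have hsplit : 2 * F.L ^ (F.m + K) = (2 * F.L ^ (F.m + K - j - m')) * (F.L ^ j * F.L ^ m') := by
    rw [← pow_add, mul_assoc, ← pow_add]
    congr 2
    omega
  rw [hsplit, div_add_one_of_mul (by have := hpow (F.m + K - j - m'); omega) (by have := Nat.mul_le_mul (hpow j) (hpow m'); simpa using this)]
  rw [mul_assoc, ← pow_add]
  congr 2
  omega

/-- Hence, along the family, `(F.P K).sitesPerDir j = domCount (F.P K) (L^{m′}) j · L^{m′}` for all large `K`. -/
theorem eventually_sitesPerDir_eq_domCount_mul (j m' : ℕ) :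
    ∀ᶠ K in atTop, (F.P K).sitesPerDir j = domCount (F.P K) (F.L ^ m') j * F.L ^ m' := by
  filter_upwards [eventually_ge_atTop (j + m')] with K hK
  exact (domCount_mul_eq_sitesPerDir_of_pow F j m' K (by omega)).symm

/-- … in particular `domCount (F.P K) (L^{m′}) j · L^{m′} ∣ (F.P K).sitesPerDir j` for all large `K` (the `hdvd` of `…_torusCast`). -/
theorem eventually_domCount_mul_dvd (j m' : ℕ) :
    ∀ᶠ K in atTop, domCount (F.P K) (F.L ^ m') j * F.L ^ m' ∣ (F.P K).sitesPerDir j :=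
  (eventually_sitesPerDir_eq_domCount_mul F j m').mono fun _ hK => dvd_of_eq hK.symm

/-- … and `domCount (F.P K) (L^{m′}) j · L^{m′} → ∞` (the `hN` of `…_torusCast`). -/
theorem tendsto_domCount_mul (j m' : ℕ) : Tendsto (fun K => domCount (F.P K) (F.L ^ m') j * F.L ^ m') atTop atTop :=
  tendsto_mul_of_sitesPerDir_eventuallyEq F j (fun K => domCount (F.P K) (F.L ^ m') j) (F.L ^ m') (eventually_sitesPerDir_eq_domCount_mul F j m')

/-! ## §2 The windowed `hK` and the windowed decay with the terms indexed by def-T's catalogue of record -/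

variable {𝔄 : Type*} [NormedRing 𝔄] [NormedAlgebra ℝ 𝔄] {V : Type*} [NormedAddCommGroup V] [NormedSpace ℝ V] {ι : Type*} [Fintype ι]
variable (j : ℕ)

/-- ★★ **dag-n22-w3's WINDOWED INPUT AT THE CATALOGUE OF RECORD.**  Terms `ℰ K X`, `ℰ' K X` indexed by `X : (Sect2.domSys (F.P K) M j).Dom` (W1-20's index type for the
level-`j` localized sum of the `K`-th torus; `M` the cube side in level-`j` units, of record `M = L^{m′}`), their charts twice continuously differentiable at `0`; per-term
soft colour-diagonal kernel-DIFFERENCE bounds at def-B's window sites with K-free `(C_E·w, κ, δ₀)`, the tails being the periodic ℓ¹ distances (cast onto `(ℤ∕domCount·M)⁴`) to the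
nearest cube of `X`; `δ₀ > 0`, `κ∕2 ≥ κ₀(64, 8)` ⇒ `∀ᶠ K, |Π^{(K)}(g; z) − Π^{(K)}(g′; z)| ≤ C_E e^{12Mδ₁} K₀(64,8) K₁(4,δ₀∕2) · w · e^{−δ₁|z|₁}`, `δ₁ = ½min{δ₀, κ(4M)⁻¹}`. -/
theorem eventually_abs_polWindow_sum_sub_le_domSys (m' : ℕ) (M : ℕ) [NeZero M] (hM : M = F.L ^ m')
    (ℰ ℰ' : (K : ℕ) → (domSys (F.P K) M j).Dom → (Fin (F.P K).d → Site (F.P K) j → 𝔄) → ℝ) (ρ : V →L[ℝ] 𝔄) (bV : Module.Basis ι ℝ V)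
    (hℰ : ∀ K X, ContDiffAt ℝ 2 (expChart (ℰ K X) ρ) 0) (hℰ' : ∀ K X, ContDiffAt ℝ 2 (expChart (ℰ' K X) ρ) 0)
    {CE w κ δ₀ : ℝ} (hCE : 0 ≤ CE) (hw : 0 ≤ w) (hδ₀ : 0 < δ₀) (hκ : kappa₀ (4 * 2 ^ 4) (2 * 4) ≤ κ / 2)
    (μ ν : Fin 4) (z : Fin 4 → ℤ)
    (hterm : ∀ (K : ℕ) (X : (domSys (F.P K) M j).Dom) (c : ι),
      let e : Site (F.P K) j → TPt 4 (domCount (F.P K) M j * M) := fun x i => (ZMod.cast (x i) : ZMod (domCount (F.P K) M j * M))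
      |polComp ℝ (expChart (ℰ K X) ρ) bV (Fin.cast (F.P_d K).symm μ) (siteOfInt F K j z) c (Fin.cast (F.P_d K).symm ν) (siteOfInt F K j 0) c -
          polComp ℝ (expChart (ℰ' K X) ρ) bV (Fin.cast (F.P_d K).symm μ) (siteOfInt F K j z) c (Fin.cast (F.P_d K).symm ν) (siteOfInt F K j 0) c| ≤
        CE * w * Real.exp (-κ * torusTreeLen X.1) *
          Real.exp (-δ₀ * distCT (domCount (F.P K) M j) M (e (siteOfInt F K j z)) (nearT (M := M) (e (siteOfInt F K j z)) X)) *
          Real.exp (-δ₀ * distCT (domCount (F.P K) M j) M (e (siteOfInt F K j 0)) (nearT (M := M) (e (siteOfInt F K j 0)) X))) :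
    ∀ᶠ K in atTop,
      |polWindow F K j (fun U => ∑ X, ℰ K X U) ρ bV μ ν z - polWindow F K j (fun U => ∑ X, ℰ' K X U) ρ bV μ ν z| ≤
        CE * Real.exp (delta1 δ₀ κ ((M : ℝ) * 4) * ((M : ℝ) * 4) * 3) * K₀ (4 * 2 ^ 4) (2 * 4) * K₁ 4 (δ₀ / 2) * w *
          Real.exp (-(delta1 δ₀ κ ((M : ℝ) * 4) * l1 z)) := by
  subst hM
  have h := eventually_abs_polWindow_sum_sub_le_torusCast F j (fun K => domCount (F.P K) (F.L ^ m') j) (F.L ^ m')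
    (eventually_domCount_mul_dvd F j m') (tendsto_domCount_mul F j m') ℰ ℰ' ρ bV hℰ hℰ' hCE hw hδ₀ hκ μ ν z hterm
  exact h

/-- **… IN dag-n22-w3's `hK` SHAPE** at the catalogue of record (history modulus `w := Σ_{i<k+1} Λ_{k+1,i}|g_i − g′_i|`, moduli `C·Λ`). -/
theorem eventually_abs_polWindow_sum_sub_le_domSys_hK (m' : ℕ) (M : ℕ) [NeZero M] (hM : M = F.L ^ m')
    (ℰ ℰ' : (K : ℕ) → (domSys (F.P K) M j).Dom → (Fin (F.P K).d → Site (F.P K) j → 𝔄) → ℝ) (ρ : V →L[ℝ] 𝔄) (bV : Module.Basis ι ℝ V)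
    (hℰ : ∀ K X, ContDiffAt ℝ 2 (expChart (ℰ K X) ρ) 0) (hℰ' : ∀ K X, ContDiffAt ℝ 2 (expChart (ℰ' K X) ρ) 0)
    {CE κ δ₀ : ℝ} (Λm : ℕ → ℕ → ℝ) (g g' : ℕ → ℝ) (k : ℕ) (hΛ : ∀ i, 0 ≤ Λm (k + 1) i)
    (hCE : 0 ≤ CE) (hδ₀ : 0 < δ₀) (hκ : kappa₀ (4 * 2 ^ 4) (2 * 4) ≤ κ / 2)
    (μ ν : Fin 4) (z : Fin 4 → ℤ)
    (hterm : ∀ (K : ℕ) (X : (domSys (F.P K) M j).Dom) (c : ι),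
      let e : Site (F.P K) j → TPt 4 (domCount (F.P K) M j * M) := fun x i => (ZMod.cast (x i) : ZMod (domCount (F.P K) M j * M))
      |polComp ℝ (expChart (ℰ K X) ρ) bV (Fin.cast (F.P_d K).symm μ) (siteOfInt F K j z) c (Fin.cast (F.P_d K).symm ν) (siteOfInt F K j 0) c -
          polComp ℝ (expChart (ℰ' K X) ρ) bV (Fin.cast (F.P_d K).symm μ) (siteOfInt F K j z) c (Fin.cast (F.P_d K).symm ν) (siteOfInt F K j 0) c| ≤
        CE * (∑ i ∈ Finset.range (k + 1), Λm (k + 1) i * |g i - g' i|) * Real.exp (-κ * torusTreeLen X.1) *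
          Real.exp (-δ₀ * distCT (domCount (F.P K) M j) M (e (siteOfInt F K j z)) (nearT (M := M) (e (siteOfInt F K j z)) X)) *
          Real.exp (-δ₀ * distCT (domCount (F.P K) M j) M (e (siteOfInt F K j 0)) (nearT (M := M) (e (siteOfInt F K j 0)) X))) :
    ∀ᶠ K in atTop,
      |polWindow F K j (fun U => ∑ X, ℰ K X U) ρ bV μ ν z - polWindow F K j (fun U => ∑ X, ℰ' K X U) ρ bV μ ν z| ≤
        Real.exp (-(delta1 δ₀ κ ((M : ℝ) * 4) * l1 z)) * ∑ i ∈ Finset.range (k + 1),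
          (CE * Real.exp (delta1 δ₀ κ ((M : ℝ) * 4) * ((M : ℝ) * 4) * 3) * K₀ (4 * 2 ^ 4) (2 * 4) * K₁ 4 (δ₀ / 2) * Λm (k + 1) i) * |g i - g' i| := by
  have hw : 0 ≤ ∑ i ∈ Finset.range (k + 1), Λm (k + 1) i * |g i - g' i| :=
    Finset.sum_nonneg fun i _ => mul_nonneg (hΛ i) (abs_nonneg _)
  have h := eventually_abs_polWindow_sum_sub_le_domSys F j m' M hM ℰ ℰ' ρ bV hℰ hℰ' hCE hw hδ₀ hκ μ ν z hterm
  filter_upwards [h] with K hK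
  rw [← const_mul_historyModulus]
  exact hK

/-- ★★ **THE WINDOWED VALUE (DECAY) BOUND AT THE CATALOGUE OF RECORD** (the (D4) road's `∀ᶠ K, |polWindow| ≤ C₀e^{−κ|z|₁}` input): per-term soft bounds on the kernel itself,
`δ₀ > 0`, `κ∕2 ≥ κ₀(64,8)` ⇒ `∀ᶠ K, |Π^{(K)}(z)| ≤ C_E e^{12Mδ₁} K₀(64,8) K₁(4,δ₀∕2) e^{−δ₁|z|₁}`. -/
theorem eventually_abs_polWindow_sum_le_domSys (m' : ℕ) (M : ℕ) [NeZero M] (hM : M = F.L ^ m')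
    (ℰ : (K : ℕ) → (domSys (F.P K) M j).Dom → (Fin (F.P K).d → Site (F.P K) j → 𝔄) → ℝ) (ρ : V →L[ℝ] 𝔄) (bV : Module.Basis ι ℝ V)
    (hℰ : ∀ K X, ContDiffAt ℝ 2 (expChart (ℰ K X) ρ) 0)
    {CE κ δ₀ : ℝ} (hCE : 0 ≤ CE) (hδ₀ : 0 < δ₀) (hκ : kappa₀ (4 * 2 ^ 4) (2 * 4) ≤ κ / 2)
    (μ ν : Fin 4) (z : Fin 4 → ℤ)
    (hterm : ∀ (K : ℕ) (X : (domSys (F.P K) M j).Dom) (c : ι),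
      let e : Site (F.P K) j → TPt 4 (domCount (F.P K) M j * M) := fun x i => (ZMod.cast (x i) : ZMod (domCount (F.P K) M j * M))
      |polComp ℝ (expChart (ℰ K X) ρ) bV (Fin.cast (F.P_d K).symm μ) (siteOfInt F K j z) c (Fin.cast (F.P_d K).symm ν) (siteOfInt F K j 0) c| ≤
        CE * Real.exp (-κ * torusTreeLen X.1) *
          Real.exp (-δ₀ * distCT (domCount (F.P K) M j) M (e (siteOfInt F K j z)) (nearT (M := M) (e (siteOfInt F K j z)) X)) *
          Real.exp (-δ₀ * distCT (domCount (F.P K) M j) M (e (siteOfInt F K j 0)) (nearT (M := M) (e (siteOfInt F K j 0)) X))) :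
    ∀ᶠ K in atTop, |polWindow F K j (fun U => ∑ X, ℰ K X U) ρ bV μ ν z| ≤
        CE * Real.exp (delta1 δ₀ κ ((M : ℝ) * 4) * ((M : ℝ) * 4) * 3) * K₀ (4 * 2 ^ 4) (2 * 4) * K₁ 4 (δ₀ / 2) *
          Real.exp (-(delta1 δ₀ κ ((M : ℝ) * 4) * l1 z)) := by
  subst hM
  have h := eventually_abs_polWindow_sum_le_torusCast F j (fun K => domCount (F.P K) (F.L ^ m') j) (F.L ^ m')
    (eventually_domCount_mul_dvd F j m') (tendsto_domCount_mul F j m') ℰ ρ bV hℰ hCE hδ₀ hκ μ ν z hterm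
  exact h

/-! ## §3 Junction to module J28's SOFT per-term output shape (`hterm_of_holomorphic_weighted`: `≤ 16·M∕r²·(w x · w y)`) — pure arithmetic -/

/-- **FROM J28-SOFT'S SHAPE TO THE SOFT KERNEL-BOUND SHAPE** (real arithmetic only; no import of J28 needed): a per-term bound `a ≤ 16·M∕r²·(w_x·w_y)` (dag-n22-c's
`YMDAG.N22.WindowOfLocalTerms.hterm_of_holomorphic_weighted`, p596444) whose sup bound carries term-level NE9 with (1.18) decay, `M ≤ M₀·w_h·e_d` (`e_d = e^{−κ d_j(X)}`,
`w_h` the history modulus), and whose site weights carry the minimizer tails of [I] p. 282, `w_x ≤ B₃·e_x`, `w_y ≤ B₃·e_y` (`e_x = e^{−δ₀ dist(x,X)}`), IS the soft bound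
`a ≤ (16 M₀ B₃²∕r²)·w_h·e_d·e_x·e_y` consumed by `hterm` in this road (all of §§1–2 above and the two earlier storeys) with `C_E := 16 M₀ B₃² ∕ r²`. -/
theorem softBound_of_weighted {a M r wx wy M₀ wh ed B₃ ex ey : ℝ} (hr : 0 < r) (hM₀ : 0 ≤ M₀) (hwh : 0 ≤ wh) (hed : 0 ≤ ed) (hB₃ : 0 ≤ B₃)
    (hex : 0 ≤ ex) (hwx : 0 ≤ wx) (hwy : 0 ≤ wy)
    (ha : a ≤ 16 * M / r ^ 2 * (wx * wy)) (hM : M ≤ M₀ * wh * ed) (hx : wx ≤ B₃ * ex) (hy : wy ≤ B₃ * ey) :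
    a ≤ 16 * M₀ * B₃ ^ 2 / r ^ 2 * wh * ed * ex * ey := by
  have hr2 : 0 < r ^ 2 := by positivity
  have h1 : 16 * M / r ^ 2 * (wx * wy) ≤ 16 * (M₀ * wh * ed) / r ^ 2 * (wx * wy) := by
    have hprod : 0 ≤ wx * wy := mul_nonneg hwx hwy
    have : 16 * M / r ^ 2 ≤ 16 * (M₀ * wh * ed) / r ^ 2 := by
      apply div_le_div_of_nonneg_right _ hr2.le
      linarith
    exact mul_le_mul_of_nonneg_right this hprod
  have h2 : wx * wy ≤ (B₃ * ex) * (B₃ * ey) := mul_le_mul hx hy hwy (mul_nonneg hB₃ hex)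
  have h3 : 0 ≤ 16 * (M₀ * wh * ed) / r ^ 2 := by positivity
  calc a ≤ 16 * M / r ^ 2 * (wx * wy) := ha
    _ ≤ 16 * (M₀ * wh * ed) / r ^ 2 * (wx * wy) := h1
    _ ≤ 16 * (M₀ * wh * ed) / r ^ 2 * ((B₃ * ex) * (B₃ * ey)) := mul_le_mul_of_nonneg_left h2 h3
    _ = 16 * M₀ * B₃ ^ 2 / r ^ 2 * wh * ed * ex * ey := by ring

/-! ## §4 Junction to the PRINTED route (4.35): the per-term soft bound from a bilinear representation on minimizer responses (`B12Decay510.kernelBound_of_repr435`'s shape) -/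

/-- **FROM (4.35)-SHAPED LEAVES TO THE SOFT KERNEL-BOUND SHAPE, at one pair of sites**: if a per-term quantity `a` (the colour-diagonal kernel or its history difference) is the
value of a form `Q` on the pair of minimizer responses `(h x, h y)` ([I] (4.35) p. 290 «𝐄^{(2)}(X) = ⟨(δ²∕δ𝐇²)𝐄(X, 1), H_j(□₀), H_j(□₀)⟩»), the form obeys the Cauchy-type bound
`|Q a b| ≤ A·e^{−κ d_j(X)}·‖a‖‖b‖` ((1.18) + (4.3)–(4.5); for a history DIFFERENCE `A` carries the modulus `Σ_iΛ_i|g_i − g′_i|`) and the responses the tails `‖h s‖ ≤ B₃ e^{−δ₀ dist(s,X)}`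
(p. 282), then `|a| ≤ (A B₃²)·e^{−κ d_j(X)}·e^{−δ₀ dist(x,X)}·e^{−δ₀ dist(y,X)}` — this road's `hterm` with `C_E := A B₃²` (the printed constant `(8B₃α₂⁻¹)²E₀` of (4.5) at `n = 2`). -/
theorem softBound_of_repr435 {W : Type*} [SeminormedAddCommGroup W] (Q : W → W → ℝ) (hx hy : W) {a A B₃ ed dx dy : ℝ} (hA : 0 ≤ A) (hB₃ : 0 ≤ B₃) (hed : 0 ≤ ed)
    (hrepr : a = Q hx hy) (hQ : ∀ u v, |Q u v| ≤ A * ed * ‖u‖ * ‖v‖) (hhx : ‖hx‖ ≤ B₃ * dx) (hhy : ‖hy‖ ≤ B₃ * dy) (hdx : 0 ≤ dx) :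
    |a| ≤ A * B₃ ^ 2 * ed * dx * dy := by
  rw [hrepr]
  have h0 : 0 ≤ A * ed := mul_nonneg hA hed
  calc |Q hx hy| ≤ A * ed * ‖hx‖ * ‖hy‖ := hQ _ _
    _ ≤ A * ed * (B₃ * dx) * ‖hy‖ := mul_le_mul_of_nonneg_right (mul_le_mul_of_nonneg_left hhx h0) (norm_nonneg _)
    _ ≤ A * ed * (B₃ * dx) * (B₃ * dy) := mul_le_mul_of_nonneg_left hhy (mul_nonneg h0 (mul_nonneg hB₃ hdx))
    _ = A * B₃ ^ 2 * ed * dx * dy := by ring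

/-! ## §5 The Σ-junction AT THE CATALOGUE OF RECORD (module J29's soft edition `abs_polWindow_localizedSum_sub_le_soft`, p597338, lands here by shape) -/

/-- ★★ **FROM J29-SOFT's Σ-SHAPED PER-`K` BOUNDS TO dag-n22-w3's `hK`, AT THE CATALOGUE OF RECORD, NO GEOMETRY PARAMETER.**  Let `Δ K` be any real sequence (of record:
`|polWindow F K (k+1) (localizedSum F S emb k hist K) … z − polWindow … hist′ … z|`) bounded for every `K` by a SUM over def-T's catalogue, `Δ K ≤ Σ_X a K X` (J29-soft gives
`a K X = 16·Mx X∕r²·(w X (site z)·w X (site 0))`), whose summands obey K-UNIFORM soft majorants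
`a K X ≤ C_E·w·e^{−κ d_j(X)}·e^{−δ₀ dist(cast site z, X)}·e^{−δ₀ dist(cast site 0, X)}` (`dist` = `distCT` to the nearest cube on `(ℤ∕domCount·M)⁴`; e.g. via `softBound_of_weighted`);
`M = L^{m′}`, `δ₀ > 0`, `κ∕2 ≥ κ₀(64,8)`.  THEN `∀ᶠ K, Δ K ≤ C_E e^{12Mδ₁} K₀(64,8) K₁(4,δ₀∕2) · w · e^{−δ₁|z|₁}`, `δ₁ = ½min{δ₀, κ(4M)⁻¹}` (the cast pull-back of `geomT` assembled inside
the proof; leaves `geomLeafT ∕ cubeSumLeafT ∕ treeLeafT`; isometry `hiso_cast` with the arithmetic of §1). -/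
theorem eventually_le_of_softSum_domSys (m' : ℕ) (M : ℕ) [NeZero M] (hM : M = F.L ^ m') (Δ : ℕ → ℝ)
    (a : (K : ℕ) → (domSys (F.P K) M j).Dom → ℝ) {CE w κ δ₀ : ℝ} (hCE : 0 ≤ CE) (hw : 0 ≤ w) (hδ₀ : 0 < δ₀) (hκ : kappa₀ (4 * 2 ^ 4) (2 * 4) ≤ κ / 2)
    (z : Fin 4 → ℤ) (hΔ : ∀ K, Δ K ≤ ∑ X, a K X)
    (ha : ∀ (K : ℕ) (X : (domSys (F.P K) M j).Dom),
      let e : Site (F.P K) j → TPt 4 (domCount (F.P K) M j * M) := fun x i => (ZMod.cast (x i) : ZMod (domCount (F.P K) M j * M))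
      a K X ≤ CE * w * Real.exp (-κ * torusTreeLen X.1) *
          Real.exp (-δ₀ * distCT (domCount (F.P K) M j) M (e (siteOfInt F K j z)) (nearT (M := M) (e (siteOfInt F K j z)) X)) *
          Real.exp (-δ₀ * distCT (domCount (F.P K) M j) M (e (siteOfInt F K j 0)) (nearT (M := M) (e (siteOfInt F K j 0)) X))) :
    ∀ᶠ K in atTop, Δ K ≤ CE * Real.exp (delta1 δ₀ κ ((M : ℝ) * 4) * ((M : ℝ) * 4) * 3) * K₀ (4 * 2 ^ 4) (2 * 4) * K₁ 4 (δ₀ / 2) * w *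
        Real.exp (-(delta1 δ₀ κ ((M : ℝ) * 4) * l1 z)) := by
  subst hM
  have hκ0 : 0 ≤ κ := by
    have h2 : (0 : ℝ) ≤ κ / 2 := (kappa₀_nonneg (c₀ := 4 * 2 ^ 4) (by positivity) (2 * 4)).trans hκ
    linarith
  have hMd : (0 : ℝ) < ((F.L ^ m' : ℕ) : ℝ) * ((4 : ℕ) : ℝ) := mul_pos (Nat.cast_pos.2 (Nat.pos_of_neZero _)) (by norm_num)
  set N : ℕ → ℕ := fun K => domCount (F.P K) (F.L ^ m') j with hN
  have hiso : ∀ᶠ K in atTop, l1 z - 0 ≤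
      pl1 ((fun (x : Site (F.P K) j) (i : Fin (F.P K).d) => (ZMod.cast (x i) : ZMod (N K * F.L ^ m'))) (siteOfInt F K j z) -
        (fun (x : Site (F.P K) j) (i : Fin (F.P K).d) => (ZMod.cast (x i) : ZMod (N K * F.L ^ m'))) (siteOfInt F K j 0)) := by
    filter_upwards [hiso_cast F j N (F.L ^ m') (eventually_domCount_mul_dvd F j m') (tendsto_domCount_mul F j m') z] with K hK
    rw [sub_zero]
    exact hK.symm.le
  have h := eventually_abs_sub_le_of_softSum F j (fun K => tsys 4 (N K)) (fun K => (tcubeSys 4 (N K)).toCubeCover)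
    (fun K =>
      { distC := fun x c => (geomT 4 (N K) (F.L ^ m')).distC (fun i => (ZMod.cast (x i) : ZMod (N K * F.L ^ m'))) c
        distD := fun x X => (geomT 4 (N K) (F.L ^ m')).distD (fun i => (ZMod.cast (x i) : ZMod (N K * F.L ^ m'))) X
        distC_nonneg := fun x c => (geomT 4 (N K) (F.L ^ m')).distC_nonneg _ c
        distD_nonneg := fun x X => (geomT 4 (N K) (F.L ^ m')).distD_nonneg _ X
        pick := fun x X => (geomT 4 (N K) (F.L ^ m')).pick (fun i => (ZMod.cast (x i) : ZMod (N K * F.L ^ m'))) X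
        pick_mem := fun x X => (geomT 4 (N K) (F.L ^ m')).pick_mem _ X
        distC_pick_le := fun x X => (geomT 4 (N K) (F.L ^ m')).distC_pick_le _ X })
    (fun K x y => pl1 ((fun i => (ZMod.cast (x i) : ZMod (N K * F.L ^ m'))) - (fun i => (ZMod.cast (y i) : ZMod (N K * F.L ^ m')))))
    Δ a hCE hw (K₀_pos _ _).le (K₁_nonneg 4 (δ₀ / 2)) (delta1_nonneg hδ₀.le hκ0 hMd) (delta1_le_half δ₀ κ _) (delta1_mul_le δ₀ κ hMd)
    (fun K X x y => geomLeafT 4 (N K) (F.L ^ m') X _ _) (fun K x => cubeSumLeafT 4 (N K) (F.L ^ m') (half_pos hδ₀) _)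
    (fun K => treeLeafT 4 (N K) hκ) z hiso hΔ ha
  simp only [mul_zero, Real.exp_zero, mul_one, Nat.cast_ofNat] at h
  exact h

/-! ## §6 CAPSTONE: W1-19b's LETTER `WindowedNE9` AT W1-20's `localizedSum` from J29-soft's Σ-bounds and K-uniform soft majorants -/

/-- ★★★ **THE SOFT ROAD DELIVERS THE LETTER.**  For node00-def-W1's term family `localizedSum F S emb` (W1-20) and a window `W` of coupling sequences: IF for every pair
`g, g′ ∈ W`, level `k`, entry `(μ, ν)`, separation `z` and run length `K` the windowed history difference is bounded by a SUM over def-T's catalogue (module J29's soft edition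
`abs_polWindow_localizedSum_sub_le_soft` at `hist := histPrefix g k`, `hist′ := histPrefix g′ k`), whose summands obey soft majorants with history modulus `Σ_{i<k+1} Λ_{k+1,i}|g_i − g′_i|`
and constants `(C_E, κ, δ₀)` NOT depending on `(g, g′, k, μ, ν, z, K)` — term-level NE9 with fading-memory moduli `Λ` × the minimizer tails — and `M = L^{m′}`, `δ₀ > 0`, `κ∕2 ≥ κ₀(64,8)`,
THEN W1-19b's binder holds: `WindowedNE9 F (localizedSum F S emb) ρ bV W δ₁ (C·Λ)` with `δ₁ = ½min{δ₀, κ(4M)⁻¹}`, `C = C_E e^{12Mδ₁} K₀(64,8) K₁(4,δ₀∕2)` — the `hK` input of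
dag-n22-w3's (1.21) passage `AtKernels.ne9_EA_of_windowed` in LETTER currency (transfer to the objects of record by W1-19b's `windowedNE9OfRecord₁₃_iff_of_localizes`). -/
theorem windowedNE9_localizedSum_of_softSum (m' : ℕ) (M : ℕ) [NeZero M] (hM : M = F.L ^ m') {𝔸 : Type*}
    (S : (K : ℕ) → ClusterTower (F.P K) 𝔸 M) (emb : ReadingMaps F 𝔄 𝔸) (ρ : V →L[ℝ] 𝔄) (bV : Module.Basis ι ℝ V)
    (W : Set (ℕ → ℝ)) {CE κ δ₀ : ℝ} (Λm : ℕ → ℕ → ℝ) (hΛ : ∀ k i, 0 ≤ Λm k i) (hCE : 0 ≤ CE) (hδ₀ : 0 < δ₀) (hκ : kappa₀ (4 * 2 ^ 4) (2 * 4) ≤ κ / 2)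
    (a : (ℕ → ℝ) → (ℕ → ℝ) → (k : ℕ) → Fin 4 → Fin 4 → (Fin 4 → ℤ) → (K : ℕ) → (domSys (F.P K) M (k + 1)).Dom → ℝ)
    (hΔ : ∀ g ∈ W, ∀ g' ∈ W, ∀ (k : ℕ) (μ ν : Fin 4) (z : Fin 4 → ℤ) (K : ℕ),
      |polWindow F K (k + 1) (localizedSum F S emb k (histPrefix g k) K) ρ bV μ ν z -
          polWindow F K (k + 1) (localizedSum F S emb k (histPrefix g' k) K) ρ bV μ ν z| ≤ ∑ X, a g g' k μ ν z K X)
    (ha : ∀ g ∈ W, ∀ g' ∈ W, ∀ (k : ℕ) (μ ν : Fin 4) (z : Fin 4 → ℤ) (K : ℕ) (X : (domSys (F.P K) M (k + 1)).Dom),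
      let e : Site (F.P K) (k + 1) → TPt 4 (domCount (F.P K) M (k + 1) * M) := fun x i => (ZMod.cast (x i) : ZMod (domCount (F.P K) M (k + 1) * M))
      a g g' k μ ν z K X ≤ CE * (∑ i ∈ Finset.range (k + 1), Λm (k + 1) i * |g i - g' i|) * Real.exp (-κ * torusTreeLen X.1) *
          Real.exp (-δ₀ * distCT (domCount (F.P K) M (k + 1)) M (e (siteOfInt F K (k + 1) z)) (nearT (M := M) (e (siteOfInt F K (k + 1) z)) X)) *
          Real.exp (-δ₀ * distCT (domCount (F.P K) M (k + 1)) M (e (siteOfInt F K (k + 1) 0)) (nearT (M := M) (e (siteOfInt F K (k + 1) 0)) X))) :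
    WindowedNE9 F (localizedSum F S emb) ρ bV W (delta1 δ₀ κ ((M : ℝ) * 4))
      (fun k i => CE * Real.exp (delta1 δ₀ κ ((M : ℝ) * 4) * ((M : ℝ) * 4) * 3) * K₀ (4 * 2 ^ 4) (2 * 4) * K₁ 4 (δ₀ / 2) * Λm k i) := by
  refine (windowedNE9_iff F (localizedSum F S emb) ρ bV W _ _).2 fun g hg g' hg' k μ ν z => ?_
  have hw : 0 ≤ ∑ i ∈ Finset.range (k + 1), Λm (k + 1) i * |g i - g' i| :=
    Finset.sum_nonneg fun i _ => mul_nonneg (hΛ _ i) (abs_nonneg _)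
  have h := eventually_le_of_softSum_domSys F (k + 1) m' M hM
    (fun K => |polWindow F K (k + 1) (localizedSum F S emb k (histPrefix g k) K) ρ bV μ ν z -
      polWindow F K (k + 1) (localizedSum F S emb k (histPrefix g' k) K) ρ bV μ ν z|)
    (fun K X => a g g' k μ ν z K X) hCE hw hδ₀ hκ z (fun K => hΔ g hg g' hg' k μ ν z K) (fun K X => ha g hg g' hg' k μ ν z K X)
  filter_upwards [h] with K hK
  rw [← const_mul_historyModulus]
  exact hK

/-- ★★★ **THE VALUE LETTER TOO**: W1-19b's `WindowedDecay F (localizedSum F S emb) ρ bV W μ ν δ₁` (the windowed (5.10)-decay binder the (D4) road consumes) from per-`(g, k, z, K)`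
Σ-shaped bounds ON THE KERNEL ITSELF at `localizedSum` (a value edition of module J29's soft theorem, displayed here as `hΔ`) and soft majorants `b … X ≤ C_E·w·e^{−κd_j X}·e^{−δ₀distCT(cast site z)}·
e^{−δ₀distCT(cast site 0)}` with `(C_E, w, κ, δ₀)` uniform in `(g, k, z, K)`; `M = L^{m′}`, `δ₀ > 0`, `κ∕2 ≥ κ₀(64,8)`; the constant is `C₀ = C_E e^{12Mδ₁}K₀(64,8)K₁(4,δ₀∕2)·w` for every `g`. -/
theorem windowedDecay_localizedSum_of_softSum (m' : ℕ) (M : ℕ) [NeZero M] (hM : M = F.L ^ m') {𝔸 : Type*}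
    (S : (K : ℕ) → ClusterTower (F.P K) 𝔸 M) (emb : ReadingMaps F 𝔄 𝔸) (ρ : V →L[ℝ] 𝔄) (bV : Module.Basis ι ℝ V)
    (W : Set (ℕ → ℝ)) {CE w κ δ₀ : ℝ} (hCE : 0 ≤ CE) (hw : 0 ≤ w) (hδ₀ : 0 < δ₀) (hκ : kappa₀ (4 * 2 ^ 4) (2 * 4) ≤ κ / 2) (μ ν : Fin 4)
    (b : (ℕ → ℝ) → (k : ℕ) → (Fin 4 → ℤ) → (K : ℕ) → (domSys (F.P K) M (k + 1)).Dom → ℝ)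
    (hΔ : ∀ g ∈ W, ∀ (k : ℕ) (z : Fin 4 → ℤ) (K : ℕ),
      |polWindow F K (k + 1) (localizedSum F S emb k (histPrefix g k) K) ρ bV μ ν z| ≤ ∑ X, b g k z K X)
    (hb : ∀ g ∈ W, ∀ (k : ℕ) (z : Fin 4 → ℤ) (K : ℕ) (X : (domSys (F.P K) M (k + 1)).Dom),
      let e : Site (F.P K) (k + 1) → TPt 4 (domCount (F.P K) M (k + 1) * M) := fun x i => (ZMod.cast (x i) : ZMod (domCount (F.P K) M (k + 1) * M))
      b g k z K X ≤ CE * w * Real.exp (-κ * torusTreeLen X.1) *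
          Real.exp (-δ₀ * distCT (domCount (F.P K) M (k + 1)) M (e (siteOfInt F K (k + 1) z)) (nearT (M := M) (e (siteOfInt F K (k + 1) z)) X)) *
          Real.exp (-δ₀ * distCT (domCount (F.P K) M (k + 1)) M (e (siteOfInt F K (k + 1) 0)) (nearT (M := M) (e (siteOfInt F K (k + 1) 0)) X))) :
    WindowedDecay F (localizedSum F S emb) ρ bV W μ ν (delta1 δ₀ κ ((M : ℝ) * 4)) := by
  refine (windowedDecay_iff F (localizedSum F S emb) ρ bV W μ ν _).2 fun g hg => ⟨CE * Real.exp (delta1 δ₀ κ ((M : ℝ) * 4) * ((M : ℝ) * 4) * 3) *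
    K₀ (4 * 2 ^ 4) (2 * 4) * K₁ 4 (δ₀ / 2) * w, fun k z => ?_⟩
  have h := eventually_le_of_softSum_domSys F (k + 1) m' M hM
    (fun K => |polWindow F K (k + 1) (localizedSum F S emb k (histPrefix g k) K) ρ bV μ ν z|)
    (fun K X => b g k z K X) hCE hw hδ₀ hκ z (fun K => hΔ g hg k z K) (fun K X => hb g hg k z K X)
  filter_upwards [h] with K hK
  rw [neg_mul]
  exact hK

end YMDAG.N22.WindowSoftTwoPoint

end
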